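import Literature.MathematicalPhysics.KineticTheory.LangevinChainSDE
import HarnessLib

/-!
# Kalman's rank condition for the linearised pinned chain, by peeling from the left bath

Trunk T-KINETIC (Literature/MathematicalPhysics/KineticTheory). Provefact unit for the named fact
`CuneoEckmannHairerReyBellet2018_thm213` (`LangevinSemigroup.lean`): the linear-algebra heart of
the controllability of the pinned anharmonic chain linearised at its equilibrium `0` (used for the
Hörmander-free local minorisation of its transition probabilities). Let `A = DY(0)` be the
differential at `0` of the Langevin drift `Y(q, p) = (p, -∂Φ(q) - γ W p)` of the pinned chain
`pinnedChain ω₂ lam β γ`, i.e. `A(q, p) = (p, -H q - γ W p)` with `H = Hess Φ(0)` the Jacobi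
matrix `H_{ii} = ω₂ + #neighbours`, `H_{i,i±1} = -V''(0) = -1`, and `W = diag([i=0]+[i=N-1])`.

* `pinnedChain_eq_zero_of_forall_pow_unitP_zero` — **Kalman's condition from the left bath**:
  a linear functional `ℓ` with `ℓ(Aᵏ (0, e₀)) = 0` for all `k` vanishes identically. Proof by
  PEELING: with `cₖ(j) = ℓ(Aᵏ(0,e_j))`, `aₖ(j) = ℓ(Aᵏ(e_j,0))` one has
  `c_{k+1}(j) = aₖ(j) - γ W_j cₖ(j)` and `a_{k+1}(j) = -∑_i H_{ij} cₖ(i)`; if `cₖ(j) = 0` for all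
  `k` and all `j ≤ s` then `aₖ(j) = 0` there, and the tridiagonal structure with
  `H_{s+1,s} = -1 ≠ 0` gives `cₖ(s+1) = 0`. Hence the Kalman vectors `Aᵏ(0,e₀)` span phase space:
  the chain is controllable by forcing the momentum of its left end alone.

## References

* E. D. Sontag, *Mathematical Control Theory* (1998), §3.3 (Kalman's rank condition);
  J.-P. Eckmann, C.-A. Pillet, L. Rey-Bellet, *Non-equilibrium statistical mechanics of
  anharmonic chains coupled to two heat baths at different temperatures*, CMP 201 (1999), §3
  (controllability of oscillator chains from the ends). [folklore]
-/

noncomputable section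

open Set Function Finset
open scoped BigOperators

namespace Literature.MathematicalPhysics.KineticTheory.HeatConduction

open OscillatorChain

variable {N : ℕ}

/-! ### The Hessian of the pinned potential at the equilibrium -/

/-- The Hessian formula is symmetric: `∂²Φ/∂q_j∂q_i = ∂²Φ/∂q_i∂q_j`. [folklore] -/
theorem OscillatorChain.hessPotential_comm (P : OscillatorChain) (N : ℕ) (i j : Fin N)
    (q : Fin N → ℝ) : P.hessPotential N i j q = P.hessPotential N j i q := by
  unfold OscillatorChain.hessPotential
  congr 1
  · by_cases h : i = j
    · subst h; rfl
    · have h' : j ≠ i := fun e => h e.symm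
      simp [h, h']
  · refine Finset.sum_congr rfl fun k _ => Finset.sum_congr rfl fun l _ => ?_
    split_ifs <;> ring

/-- The sub-diagonal of the Hessian of the pinned chain at the equilibrium:
`∂²Φ/∂q_j∂q_{j+1}(0) = -V''(0) = -1`. [folklore] -/
theorem pinnedChain_hessPotential_succ_zero (ω₂ lam β γ : ℝ) (N : ℕ) {i j : Fin N}
    (h : i.val = j.val + 1) : (pinnedChain ω₂ lam β γ).hessPotential N i j 0 = -1 := by
  rw [(pinnedChain ω₂ lam β γ).hessPotential_succ N h, Pi.zero_apply, Pi.zero_apply, sub_zero,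
    pinnedChain_deriv_deriv_V]
  ring

/-- Far from the tridiagonal the Hessian vanishes, in both index orders. [folklore] -/
theorem OscillatorChain.hessPotential_eq_zero_of_two_le (P : OscillatorChain) (N : ℕ)
    {i j : Fin N} (h : j.val + 2 ≤ i.val ∨ i.val + 2 ≤ j.val) (q : Fin N → ℝ) :
    P.hessPotential N i j q = 0 := by
  rcases h with h | h
  · exact P.hessPotential_eq_zero_of_le N h q
  · rw [P.hessPotential_comm N i j q]
    exact P.hessPotential_eq_zero_of_le N h q

/-! ### The linearised drift on the coordinate vectors -/

section Linearised

variable (ω₂ lam β γ : ℝ) (N : ℕ)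

/-- The linearised drift at `x`: `DY(x)(0, e_j) = (e_j, 0) - γ W_j (0, e_j)`. [folklore] -/
theorem pinnedChain_fderiv_drift_unitP (x : PhaseSpace N) (j : Fin N) :
    fderiv ℝ ((pinnedChain ω₂ lam β γ).drift N) x (unitP j) =
      unitQ j - (γ * bathWeight N j) • unitP j := by
  rw [(pinnedChain ω₂ lam β γ).fderiv_drift_apply (pinnedChain_contDiff_U ω₂ lam β γ)
    (pinnedChain_contDiff_V ω₂ lam β γ) N x (unitP j)]
  ext i
  · simp [unitQ, unitP]
  · simp only [Pi.zero_apply, mul_zero, Finset.sum_const_zero, neg_zero,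
      zero_sub, unitQ, unitP, Prod.snd_sub, Prod.smul_snd, Pi.sub_apply, Pi.smul_apply,
      Pi.single_apply, smul_eq_mul, mul_ite, mul_one, mul_zero]
    split_ifs with hij
    · subst hij; simp [pinnedChain]
    · simp

/-- The linearised drift at `x`: `DY(x)(e_j, 0) = -∑_i H_{ij}(q) (0, e_i)`. [folklore] -/
theorem pinnedChain_fderiv_drift_unitQ (x : PhaseSpace N) (j : Fin N) :
    fderiv ℝ ((pinnedChain ω₂ lam β γ).drift N) x (unitQ j) =
      -∑ i, (pinnedChain ω₂ lam β γ).hessPotential N i j x.1 • unitP i := by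
  rw [(pinnedChain ω₂ lam β γ).fderiv_drift_apply (pinnedChain_contDiff_U ω₂ lam β γ)
    (pinnedChain_contDiff_V ω₂ lam β γ) N x (unitQ j)]
  ext i
  · simp [unitQ, unitP, Prod.fst_sum]
  · simp only [unitQ_fst, unitQ_snd, Pi.zero_apply, mul_zero, sub_zero, Prod.snd_neg,
      Prod.snd_sum, Pi.neg_apply, Finset.sum_apply, Prod.smul_snd, unitP_snd, Pi.smul_apply,
      Pi.single_apply, smul_eq_mul, mul_ite, mul_one, mul_zero, Finset.sum_ite_eq,
      Finset.sum_ite_eq', Finset.mem_univ, if_true]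

end Linearised

/-! ### Kalman's condition by peeling -/

section Kalman

variable (ω₂ lam β γ : ℝ) {N : ℕ} (hN : 0 < N)

/-- **Kalman's rank condition for the linearised pinned chain, from the left bath**: if a linear
functional `ℓ` annihilates all the vectors `Aᵏ (0, e₀)`, `A = DY(0)`, then `ℓ = 0`; equivalently
these vectors span phase space. [folklore] -/
theorem pinnedChain_eq_zero_of_forall_pow_unitP_zero (ℓ : PhaseSpace N →ₗ[ℝ] ℝ)
    (h : ∀ k : ℕ, ℓ (((fderiv ℝ ((pinnedChain ω₂ lam β γ).drift N) 0) ^ k) (unitP ⟨0, hN⟩)) = 0) :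
    ℓ = 0 := by
  set P := pinnedChain ω₂ lam β γ with hP
  set A : PhaseSpace N →L[ℝ] PhaseSpace N := fderiv ℝ (P.drift N) 0 with hA
  -- the coefficient sequences
  set c : ℕ → Fin N → ℝ := fun k j => ℓ ((A ^ k) (unitP j)) with hc
  set a : ℕ → Fin N → ℝ := fun k j => ℓ ((A ^ k) (unitQ j)) with ha
  -- the recurrences
  have hpow : ∀ (k : ℕ) (v : PhaseSpace N), (A ^ (k + 1)) v = (A ^ k) (A v) := fun k v => by
    rw [pow_succ]
    rfl
  have hrecP : ∀ k j, c (k + 1) j = a k j - γ * bathWeight N j * c k j := by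
    intro k j
    simp only [hc, ha]
    rw [hpow, hA, pinnedChain_fderiv_drift_unitP ω₂ lam β γ N 0 j, map_sub, map_smul, map_sub,
      map_smul, smul_eq_mul]
  have hrecQ : ∀ k j, a (k + 1) j = -∑ i, P.hessPotential N i j 0 * c k i := by
    intro k j
    simp only [hc, ha]
    rw [hpow, hA, pinnedChain_fderiv_drift_unitQ ω₂ lam β γ N 0 j, map_neg, map_sum, map_neg,
      map_sum]
    congr 1
    refine Finset.sum_congr rfl fun i _ => ?_
    rw [map_smul, map_smul, smul_eq_mul, Prod.fst_zero]
  -- the hypothesis: `c k 0 = 0`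
  have hc0 : ∀ k, c k ⟨0, hN⟩ = 0 := h
  -- `c k j = 0` and `a k j = 0` once `c` vanishes at `j`
  have ha_of_c : ∀ j, (∀ k, c k j = 0) → ∀ k, a k j = 0 := by
    intro j hj k
    have := hrecP k j
    rw [hj (k + 1), hj k] at this
    linarith
  -- peeling induction on the site
  have hpeel : ∀ s : ℕ, ∀ j : Fin N, j.val ≤ s → ∀ k, c k j = 0 := by
    intro s
    induction s with
    | zero =>
      intro j hj k
      have : j = ⟨0, hN⟩ := Fin.ext (Nat.le_zero.mp hj)
      rw [this]
      exact hc0 k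
    | succ s ih =>
      intro j hj
      by_cases hj' : j.val ≤ s
      · exact ih j hj'
      · have hjs : j.val = s + 1 := by omega
        have hslt : s < N := by omega
        set j₀ : Fin N := ⟨s, hslt⟩ with hj₀
        intro k
        -- `a (k+1) j₀ = 0` and `= -H_{j j₀} c k j`
        have h1 : a (k + 1) j₀ = 0 := ha_of_c j₀ (ih j₀ (by simp [hj₀])) (k + 1)
        rw [hrecQ k j₀] at h1
        have hsum : ∑ i, P.hessPotential N i j₀ 0 * c k i = P.hessPotential N j j₀ 0 * c k j := by
          refine Finset.sum_eq_single j (fun i _ hij => ?_) (by simp)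
          by_cases his : i.val ≤ s
          · rw [ih i his k, mul_zero]
          · have hfar : j₀.val + 2 ≤ i.val := by
              have : i.val ≠ s + 1 := fun e => hij (Fin.ext (by rw [e, hjs]))
              simp only [hj₀]
              omega
            rw [P.hessPotential_eq_zero_of_le N hfar, zero_mul]
        rw [hsum, pinnedChain_hessPotential_succ_zero ω₂ lam β γ N (by rw [hjs]), neg_eq_zero] at h1
        linarith
  have hcall : ∀ j k, c k j = 0 := fun j k => hpeel j.val j le_rfl k
  have haall : ∀ j k, a k j = 0 := fun j => ha_of_c j fun k => hcall j k
  -- conclude on the basis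
  refine LinearMap.ext fun v => ?_
  rw [eq_sum_unitQ_add_sum_unitP v, map_add, map_sum, map_sum]
  simp only [map_smul, smul_eq_mul, LinearMap.zero_apply]
  have hQ : ∀ i, ℓ (unitQ i) = 0 := fun i => by simpa [ha] using haall i 0
  have hP' : ∀ i, ℓ (unitP i) = 0 := fun i => by simpa [hc] using hcall i 0
  simp [hQ, hP']

end Kalman

end Literature.MathematicalPhysics.KineticTheory.HeatConduction
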